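import Literature.NumberTheory.GaloisRepresentations.UnramifiedLabelledWeights
import Literature.NumberTheory.GaloisRepresentations.PstWeilDeligneModelIndependence
import Literature.NumberTheory.PAdicHodge.FontaineDpstUnconditional
import Literature.NumberTheory.PAdicHodge.PadicBaseField
import Mathlib.NumberTheory.Padics.RingHoms
import HarnessLib

/-!
# `card HT_τ(ρ) = n` for de Rham `ρ : Γ_K → GL_n(ℚ̄_p)`; finiteness of the Hodge filtration on `D_τ`

Topic `Literature/NumberTheory/GaloisRepresentations`; theorems only (no definition, no named fact).
Companion of the accepted `LabelledHodgeTateWeights` (`HT_τ(ρ) = PeriodRingData.labelledHodgeTateWeights`,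
whose module docstring lists as NOT treated: "`card HT_τ(ρ) = n` for de Rham `ρ` of `E`-rank `n`
(needs: admissible ⇒ `D` free of rank `n` over `F ⊗_P E` …); the file proves the reduction
`card_labelledHodgeTateWeights` to `dim_E D_τ = n` plus finiteness of the filtration on `D_τ`"),
of `UnramifiedLabelledWeightsFinite` / `UnramifiedLabelledWeights` (the same statements for the
TRUNCATED datum `K̂_nr` and UNRAMIFIED `ρ`, whose architecture is reused verbatim), of
`LabelledWeightsInvariance` (change of frame and of finite model), `PstWeilDeligneModelIndependence`
(de Rham-ness does not depend on the finite model) and `FontaineDpstUnconditional` (the period ring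
of THE pinned datum is Fontaine's `B_dR`, a field).

## Mathematics

Let `𝔅 = (B, Γ ↷, F = B^Γ, Fil^•)` be a period-ring datum over the prime field `P`, `E ⊇ P` a
coefficient field and `ρ` an `E`-linear representation of `Γ` on `M`; `D(ρ) = (M ⊗_P B)^Γ`,
`D_τ(ρ)` its `τ`-component for `τ : F → E`, `Fil^i D_τ = D_τ ∩ (M ⊗ Fil^i B)` and `HT_τ(ρ)` the jumps
of `i ↦ dim_E Fil^i D_τ` (Patrikis 2019, §2.3.1, §2.7.1).

1. **Finiteness of the filtration.**  In a `P`-basis of `M`, `M ⊗_P B ≅ ⊕ B` coordinatewise, and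
   `M ⊗ N ⊆ M ⊗_P B` (for a `P`-subspace `N ⊆ B`) consists of the tensors all of whose coordinates
   lie in `N`.  Hence `⋂_i (M ⊗ Fil^i B) = M ⊗ (⋂_i Fil^i B) = 0` (the filtration of `B` is
   separated) and every tensor lies in some `M ⊗ Fil^a B` (it is exhaustive); so for a
   FINITE-DIMENSIONAL `D_τ` there are `a ≤ b` with `Fil^a D_τ = D_τ`, `Fil^b D_τ = 0`, and
   `card HT_τ(ρ) = dim_E D_τ(ρ)` (accepted `card_labelledHodgeTateWeights`).
2. **`dim_E D_τ(ρ) = n`** for a `B`-ADMISSIBLE framed `ρ : Γ → GL_n(E)` (`E/P` finite, splitting `F`)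
   when `B` is a field: Fontaine's `B · D(ρ) = B ⊗ Eⁿ`, the rank lower bound over the twisted period
   rings `B ⊗_{F,τ} E` and the count `dim_E D(ρ) = Σ_τ dim_E D_τ ≤ n [F : P]` — VERBATIM the accepted
   `finrank_labelD_eq_of_unramified`, with admissibility as the hypothesis instead of unramifiedness
   (Fontaine 1994, Exp. III §1.5: `D(ρ)` is free of rank `n` over `F ⊗_P E`; Patrikis §2.3.1).
3. **`ℚ̄_p`-coefficients.**  For a `p`-adic field `K`, a datum `𝔅` with `B` a field and
   `ρ : Γ_K →ₜ* GL_n(ℚ̄_p)` de Rham in the tree's sense (`FramedRep.IsDeRhamWith`: some finite model is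
   `B`-admissible): every finite model is admissible (accepted model independence
   `IsDeRhamWith.isAdmissible_of_hasQlModel`), in particular a model over a finite `E' ⊆ ℚ̄_p`
   containing all `τ(K)`; by 2. and the accepted invariance of `dim D_τ` under change of model and of
   frame, `D_τ(ρ)` is finite-dimensional over `ℚ̄_p` of dimension `n`, hence **`card HT_τ(ρ) = n`**
   for every `ℚ_p`-embedding `τ : K → ℚ̄_p` (Patrikis §2.7.1; Buzzard–Gee §2.4: an `n`-dimensional de
   Rham representation has `n` labelled Hodge–Tate weights at each label).
4. **The pinned datum.**  For Fontaine's datum `fontainePst F p hp` (period ring `B_dR(F)`, a field,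
   accepted `fontainePst_𝔅_eq_bdRPeriodRingData`) and the summit's `fontainePstAdicCompletion v p hv`,
   3. applies unconditionally; for the latter a CONTINUOUS `τ : K_v →+* ℚ̄_p` is automatically a
   `ℚ_p`-algebra map (a continuous ring map `ℚ_p → ℚ̄_p` is the inclusion: density of `ℤ` in `ℤ_p`),
   so the labelled weights `FramedGaloisRep.labelledHodgeTateWeightsAt` of the summit statements at a
   de Rham place have exactly `n` elements.  This is the bookkeeping behind reading the clause
   "de Rham at `v ∣ p` with multiplicity-free labelled weights" of a rank-two `ρ` (e.g. in
   `Literature.NumberTheory.Automorphic.Pan2022_proModularDeRhamClassical_GL2Q`) as "Hodge–Tate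
   weights `a < b`", i.e. `0, k` with `k > 0` after a Tate twist (Pan, arXiv:2209.06366, Thm. 1.1.2 (2)
   and §7.2.1).

## Main results

* `PeriodRingData.iInf_range_map_subtype_eq_bot`, `PeriodRingData.range_map_subtype_inf_eq_bot`,
  `PeriodRingData.iInf_coeffFilTensor_eq_bot`, `PeriodRingData.exists_mem_coeffFilTensor`,
  `PeriodRingData.exists_forall_mem_coeffFilTensor` — 1.: `⋂_i (M ⊗ N_i) = 0` for `⋂_i N_i = 0`,
  `(M ⊗ N₁) ∩ (M ⊗ N₂) = 0` for `N₁ ∩ N₂ = 0`, separation / exhaustion of `M ⊗ Fil^• B`.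
* `PeriodRingData.labelFilD_le_coeffFilTensor`, `PeriodRingData.exists_labelFilD_eq_labelD`,
  `PeriodRingData.exists_labelFilD_eq_bot`, `PeriodRingData.card_labelledHodgeTateWeights_eq_finrank`
  — for finite-dimensional `D_τ`: `Fil^a D_τ = D_τ`, `Fil^b D_τ = 0`, `card HT_τ(ρ) = dim_E D_τ(ρ)`.
* `PeriodRingData.finrank_labelD_eq_of_isAdmissible` — 2.; `PeriodRingData.finiteDimensional_span_image`
  (the `E`-span of the image of a finite-dimensional `E₀`-subspace is finite-dimensional).
* `FramedRep.IsDeRhamWith.finiteDimensional_labelD_and_finrank_eq`, `….finiteDimensional_labelD`,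
  `….finrank_labelD_eq`, `….card_labelledHodgeTateWeights_eq`;
  `PstWeilDeligneData.IsDeRhamFramed.card_labelledHodgeTateWeights_eq`,
  `….finiteDimensional_labelD_and_finrank_eq` — 3.
* `RingHom.padic_ext_of_continuous`; `Literature.NumberTheory.PAdicHodge.finiteDimensional_padicAlgebra`,
  `….fontainePst_finiteDimensional`, `….isField_fontainePst_B`,
  `….fontainePst_card_labelledHodgeTateWeights_eq`, `….fontainePst_finiteDimensional_labelD_and_finrank_eq`,
  `….adicCompletion_ringHom_commutes_of_continuous`,
  `FramedGaloisRep.card_labelledHodgeTateWeightsAt_eq_of_isDeRhamFramed`,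
  `FramedGaloisRep.exists_labelledHodgeTateWeightsAt_eq_pair` — 4.

## References

* J.-M. Fontaine, *Représentations p-adiques semi-stables*, Astérisque 223 (1994), Exp. III §1.5
  (Prop. 1.5.2: `D_B` of an admissible representation is free, compatibility with the filtration).
  [FontaineAsterisque223III]
* S. Patrikis, *Variations on a theorem of Tate*, Mem. AMS 258 (2019), §2.3.1, §2.7.1. [Patrikis2019]
* K. Buzzard, T. Gee, *The conjectural connections between automorphic representations and Galois
  representations* (2014), §2.4. [BuzzardGeeLMS2014]
* L. Pan, arXiv:2209.06366 (2022), Thm. 1.1.2 (2), §7.2.1. [Pan2022LocallyAnalyticII]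
-/

noncomputable section

open scoped TensorProduct NumberField
open TensorProduct Module Field

namespace Literature.NumberTheory.GaloisRepresentations

namespace PeriodRingData

universe u v v' w

-- Mathlib's own global value of `maxSynthPendingDepth` (the project default `1` makes nested
-- instance problems on submodules of `M ⊗[P] 𝔅.B` fail spuriously; see `PAdicHodgeProofs`); the
-- large tensor types also need a higher instance-synthesis budget (as in `LabelledWeightsTwist`).
set_option maxSynthPendingDepth 3
set_option synthInstance.maxHeartbeats 200000

/-! ### Coordinates: separation and exhaustion of `M ⊗ Fil^• B` -/

section Coords

variable {Γ : Type u} [Group Γ] {P : Type v} {F : Type v'} [Field P] [Field F] [Algebra P F]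
  {E : Type*} [Field E] [Algebra P E]
  {M : Type*} [AddCommGroup M] [Module E M] [Module P M] [IsScalarTower P E M]
  (𝔅 : PeriodRingData.{u, v, v', w} Γ P F)

open scoped Classical in
/-- **Coordinates of `M ⊗ N`.**  In the `P`-basis `Basis.ofVectorSpace P M` of `M`, every
coordinate of a tensor in the image of `M ⊗_P N → M ⊗_P B` (`N ⊆ B` a `P`-subspace) lies in `N`.
[folklore] -/
private theorem coords_mem_of_mem_range (N : Submodule P 𝔅.B) {x : M ⊗[P] 𝔅.B}
    (hx : x ∈ LinearMap.range (AlgebraTensorModule.map (LinearMap.id : M →ₗ[E] M) N.subtype))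
    (k : Basis.ofVectorSpaceIndex P M) :
    (TensorProduct.congr (Basis.ofVectorSpace P M).repr (LinearEquiv.refl P 𝔅.B) ≪≫ₗ
      finsuppScalarLeft P 𝔅.B (Basis.ofVectorSpaceIndex P M)) x k ∈ N := by
  obtain ⟨y, rfl⟩ := hx
  induction y using TensorProduct.induction_on with
  | zero =>
    rw [LinearMap.map_zero, LinearEquiv.map_zero, Finsupp.zero_apply]
    exact N.zero_mem
  | tmul m b =>
    rw [AlgebraTensorModule.map_tmul, LinearMap.id_apply, Submodule.subtype_apply]
    simp only [LinearEquiv.trans_apply, TensorProduct.congr_tmul, LinearEquiv.refl_apply,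
      finsuppScalarLeft_apply_tmul_apply]
    exact N.smul_mem _ b.2
  | add x y hx hy =>
    rw [map_add, map_add, Finsupp.add_apply]
    exact N.add_mem hx hy

/-- **`⋂_i (M ⊗ N_i) = 0` when `⋂_i N_i = 0`** (`M` is free over the field `P`: coordinatewise).
[folklore] -/
theorem iInf_range_map_subtype_eq_bot {ι : Sort*} (N : ι → Submodule P 𝔅.B) (hN : ⨅ i, N i = ⊥) :
    ⨅ i, LinearMap.range (AlgebraTensorModule.map (LinearMap.id : M →ₗ[E] M) (N i).subtype) = ⊥ := by
  classical
  refine (Submodule.eq_bot_iff _).2 fun x hx => ?_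
  set e := TensorProduct.congr (Basis.ofVectorSpace P M).repr (LinearEquiv.refl P 𝔅.B) ≪≫ₗ
    finsuppScalarLeft P 𝔅.B (Basis.ofVectorSpaceIndex P M) with he
  have hcoord : ∀ k, e x k = 0 := fun k => by
    have hk : e x k ∈ ⨅ i, N i :=
      (Submodule.mem_iInf _).2 fun i => 𝔅.coords_mem_of_mem_range (N i) ((Submodule.mem_iInf _).1 hx i) k
    rwa [hN, Submodule.mem_bot] at hk
  have hex : e x = 0 := Finsupp.ext hcoord
  exact e.injective (by rw [hex, map_zero])

/-- **`(M ⊗ N₁) ∩ (M ⊗ N₂) = 0` when `N₁ ∩ N₂ = 0`** (coordinatewise). [folklore] -/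
theorem range_map_subtype_inf_eq_bot (N₁ N₂ : Submodule P 𝔅.B) (hN : N₁ ⊓ N₂ = ⊥) :
    LinearMap.range (AlgebraTensorModule.map (LinearMap.id : M →ₗ[E] M) N₁.subtype) ⊓
      LinearMap.range (AlgebraTensorModule.map (LinearMap.id : M →ₗ[E] M) N₂.subtype) = ⊥ := by
  have h := 𝔅.iInf_range_map_subtype_eq_bot (M := M) (E := E) (fun b : Bool => cond b N₁ N₂)
    (by rw [iInf_bool_eq]; exact hN)
  rw [iInf_bool_eq] at h
  exact h

/-- **The filtration `M ⊗ Fil^• B` is separated**: `⋂_i (M ⊗ Fil^i B) = 0`.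
[cite: FontaineAsterisque223III, Exp. III §1.5] -/
theorem iInf_coeffFilTensor_eq_bot : ⨅ i, 𝔅.coeffFilTensor E M i = ⊥ :=
  𝔅.iInf_range_map_subtype_eq_bot (fun i => (𝔅.fil i).restrictScalars P) (by
    refine (Submodule.eq_bot_iff _).2 fun b hb => ?_
    have hb' : b ∈ ⨅ i, 𝔅.fil i :=
      (Submodule.mem_iInf _).2 fun i => (Submodule.mem_iInf _).1 hb i
    rwa [𝔅.iInf_fil, Submodule.mem_bot] at hb')

/-- **The filtration `M ⊗ Fil^• B` is exhaustive**: every tensor lies in some `M ⊗ Fil^a B`.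
[cite: FontaineAsterisque223III, Exp. III §1.5] -/
theorem exists_mem_coeffFilTensor (x : M ⊗[P] 𝔅.B) : ∃ a, x ∈ 𝔅.coeffFilTensor E M a := by
  induction x using TensorProduct.induction_on with
  | zero => exact ⟨0, zero_mem _⟩
  | tmul m b =>
    have hb : b ∈ ⨆ i, 𝔅.fil i := by rw [𝔅.iSup_fil]; trivial
    have hdir : Directed (· ≤ ·) 𝔅.fil := fun i j =>
      ⟨min i j, 𝔅.fil_antitone (min_le_left i j), 𝔅.fil_antitone (min_le_right i j)⟩
    obtain ⟨i, hi⟩ := (Submodule.mem_iSup_of_directed _ hdir).1 hb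
    exact ⟨i, ⟨m ⊗ₜ ⟨b, hi⟩, rfl⟩⟩
  | add x y hx hy =>
    obtain ⟨a, ha⟩ := hx
    obtain ⟨b, hb⟩ := hy
    exact ⟨min a b, add_mem (𝔅.coeffFilTensor_antitone E M (min_le_left a b) ha)
      (𝔅.coeffFilTensor_antitone E M (min_le_right a b) hb)⟩

/-- Every finite set of tensors lies in a common `M ⊗ Fil^a B`. [folklore] -/
theorem exists_forall_mem_coeffFilTensor (s : Finset (M ⊗[P] 𝔅.B)) :
    ∃ a, ∀ x ∈ s, x ∈ 𝔅.coeffFilTensor E M a := by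
  classical
  refine Finset.induction_on s ⟨0, fun x hx => absurd hx (Finset.notMem_empty x)⟩ ?_
  intro x s _ ih
  obtain ⟨a, ha⟩ := ih
  obtain ⟨b, hb⟩ := 𝔅.exists_mem_coeffFilTensor (E := E) x
  refine ⟨min a b, fun y hy => ?_⟩
  rcases Finset.mem_insert.1 hy with rfl | hy
  · exact 𝔅.coeffFilTensor_antitone E M (min_le_right a b) hb
  · exact 𝔅.coeffFilTensor_antitone E M (min_le_left a b) (ha y hy)

end Coords

/-! ### Finite-dimensional `D_τ`: the Hodge filtration is finite and `card HT_τ = dim D_τ` -/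

section FiniteLabel

variable {Γ : Type u} [Group Γ] [TopologicalSpace Γ] {P : Type v} {F : Type v'} [Field P]
  [Field F] [Algebra P F]
  {E : Type*} [Field E] [Algebra P E] [TopologicalSpace E]
  {M : Type*} [AddCommGroup M] [Module E M] [Module P M] [IsScalarTower P E M]
  [TopologicalSpace M]
  (𝔅 : PeriodRingData.{u, v, v', w} Γ P F) (ρ : ContinuousRep Γ E M) (τ : F →+* E)

/-- `Fil^i D_τ ⊆ M ⊗ Fil^i B`. [folklore] -/
theorem labelFilD_le_coeffFilTensor (i : ℤ) : 𝔅.labelFilD ρ τ i ≤ 𝔅.coeffFilTensor E M i := by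
  rw [labelFilD]
  exact inf_le_right

/-- **`Fil^a D_τ = D_τ` for some `a`** when `D_τ` is finite-dimensional (a finite spanning set lies in
a common `M ⊗ Fil^a B`). [cite: FontaineAsterisque223III, Exp. III §1.5] -/
theorem exists_labelFilD_eq_labelD [FiniteDimensional E (𝔅.labelD ρ τ)] :
    ∃ a, 𝔅.labelFilD ρ τ a = 𝔅.labelD ρ τ := by
  obtain ⟨s, hs⟩ := (Submodule.fg_iff_finiteDimensional _).2 ‹FiniteDimensional E (𝔅.labelD ρ τ)›
  obtain ⟨a, ha⟩ := 𝔅.exists_forall_mem_coeffFilTensor (E := E) s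
  refine ⟨a, ?_⟩
  rw [labelFilD]
  refine inf_eq_left.2 ?_
  rw [← hs, Submodule.span_le]
  exact fun x hx => ha x hx

/-- **`Fil^b D_τ = 0` for some `b`** when `D_τ` is finite-dimensional: the decreasing chain
`Fil^• D_τ` is eventually constant, and its stable value lies in `⋂_i (M ⊗ Fil^i B) = 0`.
[cite: FontaineAsterisque223III, Exp. III §1.5] -/
theorem exists_labelFilD_eq_bot [FiniteDimensional E (𝔅.labelD ρ τ)] :
    ∃ b, 𝔅.labelFilD ρ τ b = ⊥ := by
  haveI : ∀ i, FiniteDimensional E (𝔅.labelFilD ρ τ i) :=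
    fun i => Submodule.finiteDimensional_of_le (𝔅.labelFilD_le ρ τ i)
  set d : ℕ → ℕ := fun m => Module.finrank E (𝔅.labelFilD ρ τ (m : ℤ)) with hd
  -- a minimum of `d`
  obtain ⟨m₀, hm₀⟩ : ∃ m₀, d m₀ = sInf (Set.range d) := Nat.sInf_mem (s := Set.range d) ⟨d 0, 0, rfl⟩
  have hmin : ∀ m, d m₀ ≤ d m := fun m => by rw [hm₀]; exact Nat.sInf_le ⟨m, rfl⟩
  -- the chain is constant from `m₀` on
  have hconst : ∀ m : ℕ, m₀ ≤ m → 𝔅.labelFilD ρ τ (m : ℤ) = 𝔅.labelFilD ρ τ (m₀ : ℤ) := by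
    intro m hm
    have hle : 𝔅.labelFilD ρ τ (m : ℤ) ≤ 𝔅.labelFilD ρ τ (m₀ : ℤ) :=
      𝔅.labelFilD_antitone ρ τ (Int.ofNat_le.2 hm)
    exact Submodule.eq_of_le_of_finrank_eq hle (le_antisymm (Submodule.finrank_mono hle) (hmin m))
  refine ⟨(m₀ : ℤ), eq_bot_iff.2 fun x hx => ?_⟩
  have hall : ∀ i : ℤ, x ∈ 𝔅.labelFilD ρ τ i := by
    intro i
    by_cases hi : i ≤ (m₀ : ℤ)
    · exact 𝔅.labelFilD_antitone ρ τ hi hx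
    · have hi' : (m₀ : ℤ) ≤ i := le_of_not_ge hi
      obtain ⟨m, rfl⟩ := Int.eq_ofNat_of_zero_le ((Int.natCast_nonneg m₀).trans hi')
      rw [hconst m (Int.ofNat_le.1 hi')]
      exact hx
  have hmem : x ∈ ⨅ i, 𝔅.coeffFilTensor E M i :=
    (Submodule.mem_iInf _).2 fun i => 𝔅.labelFilD_le_coeffFilTensor ρ τ i (hall i)
  rw [𝔅.iInf_coeffFilTensor_eq_bot] at hmem
  exact hmem

/-- **`card HT_τ(ρ) = dim_E D_τ(ρ)`** whenever `D_τ(ρ)` is finite-dimensional (the Hodge filtration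
on `D_τ` is then exhausted and separated at finite stages; accepted
`card_labelledHodgeTateWeights`). [cite: Patrikis2019, §2.3.1] [cite: FontaineAsterisque223III, Exp. III §1.5] -/
theorem card_labelledHodgeTateWeights_eq_finrank [FiniteDimensional E (𝔅.labelD ρ τ)] :
    Multiset.card (𝔅.labelledHodgeTateWeights ρ τ) = Module.finrank E (𝔅.labelD ρ τ) := by
  obtain ⟨a, ha⟩ := 𝔅.exists_labelFilD_eq_labelD ρ τ
  obtain ⟨b, hb⟩ := 𝔅.exists_labelFilD_eq_bot ρ τ
  exact 𝔅.card_labelledHodgeTateWeights ρ τ ha hb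

end FiniteLabel

/-! ### `dim_E D_τ(ρ) = n` for admissible framed representations with finite coefficients -/

section Admissible

variable {Γ : Type u} [Group Γ] [TopologicalSpace Γ] {P : Type v} {F : Type v'} [Field P]
  [Field F] [Algebra P F] [TopologicalSpace P]
  {E : Type*} [Field E] [Algebra P E] [TopologicalSpace E] [IsTopologicalRing E]
  (𝔅 : PeriodRingData.{u, v, v', w} Γ P F)

/-- **`D_τ(ρ)` is finite-dimensional of dimension `n` for a `B`-admissible `ρ : Γ → GL_n(E)`**, `E/P`
finite splitting `F`, when the period ring `B` is a FIELD: `D(ρ) = (Eⁿ ⊗_P B)^Γ` is free of rank `n`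
over `E ⊗_P F`.  (The accepted `finrank_labelD_eq_of_unramified` for `K̂_nr` and unramified `ρ`,
with admissibility as the hypothesis: Fontaine's `B · D(ρ) = B ⊗ Eⁿ` (`span_D_eq_top`), the rank lower
bound over `B ⊗_{F,τ} E` and the count `dim_E D(ρ) ≤ n [F : P]`.)
[cite: FontaineAsterisque223III, Exp. III Prop. 1.5.2] [cite: Patrikis2019, §2.3.1] -/
theorem finrank_labelD_eq_of_isAdmissible (hB : IsField 𝔅.B) [FiniteDimensional P F]
    [Algebra.IsSeparable P F] [FiniteDimensional P E]
    (hsplit : Fintype.card (F →ₐ[P] E) = Module.finrank P F) {n : ℕ} (rE : FramedRep Γ E n)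
    (hadm : 𝔅.IsAdmissible ((FramedRep.toContinuousRep rE).restrictScalars P)) (τ : F →ₐ[P] E) :
    Module.Finite E (𝔅.labelD (FramedRep.toContinuousRep rE) τ.toRingHom) ∧
      Module.finrank E (𝔅.labelD (FramedRep.toContinuousRep rE) τ.toRingHom) = n := by
  haveI : Module.Finite F (𝔅.D ((FramedRep.toContinuousRep rE).restrictScalars P)) :=
    Module.rank_lt_aleph0_iff.1 ((𝔅.rank_D_le _).trans_lt Cardinal.natCast_lt_aleph0)
  have hDeq : Module.finrank F (𝔅.D ((FramedRep.toContinuousRep rE).restrictScalars P)) =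
      Module.finrank P (Fin n → E) := hadm
  obtain ⟨hfinC, htotal⟩ := 𝔅.finite_coeffD_and_finrank_le (FramedRep.toContinuousRep rE) hDeq.le
  haveI := hfinC
  refine ⟨Submodule.finiteDimensional_of_le (S₂ := 𝔅.coeffD (FramedRep.toContinuousRep rE))
    (𝔅.labelD_le_coeffD (FramedRep.toContinuousRep rE) τ.toRingHom), ?_⟩
  exact 𝔅.finrank_labelD_eq_of_finrank_coeffD_le (FramedRep.toContinuousRep rE) hsplit
    (𝔅.exists_sum_baseActB_eq_of_span_D_eq_top (FramedRep.toContinuousRep rE)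
      (𝔅.span_D_eq_top hB _ hadm)) htotal τ

end Admissible

/-! ### Spans of images of finite-dimensional subspaces along a semilinear inclusion -/

section SpanImage

variable {E₀ E : Type*} [Field E₀] [Field E] [Algebra E₀ E]
  {V₀ V : Type*} [AddCommGroup V₀] [Module E₀ V₀] [AddCommGroup V] [Module E V] [Module E₀ V]
  [IsScalarTower E₀ E V]

/-- The `E`-span of the image of a finite-dimensional `E₀`-subspace under an `E₀`-linear map into an
`E`-vector space is finite-dimensional over `E`. [folklore] -/
theorem finiteDimensional_span_image (f : V₀ →ₗ[E₀] V) (W : Submodule E₀ V₀)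
    [FiniteDimensional E₀ W] :
    FiniteDimensional E (Submodule.span E (f '' (W : Set V₀))) := by
  obtain ⟨t, ht⟩ := (Submodule.fg_iff_finiteDimensional _).2 ‹FiniteDimensional E₀ W›
  haveI : FiniteDimensional E (Submodule.span E (f '' (t : Set V₀))) :=
    FiniteDimensional.span_of_finite E ((t.finite_toSet).image f)
  refine Submodule.finiteDimensional_of_le (S₂ := Submodule.span E (f '' (t : Set V₀)))
    (Submodule.span_le.2 ?_)
  rintro _ ⟨w, hw, rfl⟩
  have hw' : w ∈ Submodule.span E₀ (t : Set V₀) := by rw [ht]; exact hw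
  have hfw : f w ∈ Submodule.span E₀ (f '' (t : Set V₀)) := by
    rw [← Submodule.map_span]
    exact Submodule.mem_map_of_mem hw'
  exact (Submodule.span_le.2 fun y hy => Submodule.subset_span hy :
    Submodule.span E₀ (f '' (t : Set V₀)) ≤ (Submodule.span E (f '' (t : Set V₀))).restrictScalars E₀) hfw

end SpanImage

end PeriodRingData

/-! ### `ℚ̄_p`-coefficients: de Rham representations of `Γ_K` -/

namespace FramedRep.IsDeRhamWith

open Literature.NumberTheory.Automorphic PeriodRingData

-- Mathlib's own global value of `maxSynthPendingDepth` (see `LabelledWeightsTwist`); the large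
-- tensor types also need a higher instance-synthesis budget.
set_option maxSynthPendingDepth 3
set_option synthInstance.maxHeartbeats 200000

variable {K : Type} [Field K] {p : ℕ} [Fact p.Prime] [Algebra ℚ_[p] K]

/-- **`D_τ(ρ)` of a de Rham `ρ : Γ_K →ₜ* GL_n(ℚ̄_p)` is finite-dimensional over `ℚ̄_p` of dimension `n`**
(for a period-ring datum `𝔅` whose period ring is a field, e.g. `B_dR(K)`, and `K/ℚ_p` finite): a
finite model of `ρ` over `E' ⊆ ℚ̄_p` containing every `τ(K)` is `B`-admissible (accepted model
independence `isAdmissible_of_hasQlModel`), `dim_{E'} D_{τ₀} = n` there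
(`finrank_labelD_eq_of_isAdmissible`), and `D_τ(ρ) = ℚ̄_p · ι(D_{τ₀})` up to the change of frame
(accepted `labelD_baseChange_eq_span`, `labelD_conj`).
[cite: FontaineAsterisque223III, Exp. III Prop. 1.5.2] [cite: Patrikis2019, §2.7.1] -/
theorem finiteDimensional_labelD_and_finrank_eq [FiniteDimensional ℚ_[p] K]
    (𝔅 : PeriodRingData.{0, 0, 0, 0} (absoluteGaloisGroup K) ℚ_[p] K) (hB : IsField 𝔅.B) {n : ℕ}
    {ρ : FramedRep (absoluteGaloisGroup K) (PadicAlgCl p) n}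
    (hρ : ρ.IsDeRhamWith ‹Algebra ℚ_[p] K› 𝔅) (τ : K →ₐ[ℚ_[p]] PadicAlgCl p) :
    FiniteDimensional (PadicAlgCl p) (𝔅.labelD (FramedRep.toContinuousRep ρ) τ.toRingHom) ∧
      Module.finrank (PadicAlgCl p) (𝔅.labelD (FramedRep.toContinuousRep ρ) τ.toRingHom) = n := by
  classical
  -- a finite model `rE₀` over `E₀`, enlarged to `E'` containing all embeddings of `K`
  obtain ⟨E₀, hfin₀, rE₀, hmodel₀, -⟩ := id hρ
  haveI : FiniteDimensional ℚ_[p] E₀ := hfin₀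
  obtain ⟨E', hfin', hle, hE'⟩ := exists_intermediateField_ge_forall_fieldRange_le (K := K) E₀
  haveI : FiniteDimensional ℚ_[p] E' := hfin'
  have hsplit := card_algHom_eq_finrank_of_forall_fieldRange_le (K := K) E' hE'
  have hcont : Continuous (IntermediateField.inclusion hle).toRingHom := continuous_inclusion hle
  let rE' : FramedRep (absoluteGaloisGroup K) E' n :=
    rE₀.baseChange (IntermediateField.inclusion hle).toRingHom hcont
  -- `ρ` is a conjugate of the base change of `rE'`; in particular `rE'` is a model of `ρ`
  obtain ⟨Q, hQ⟩ := hmodel₀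
  have hbc : rE'.baseChange (algebraMap E' (PadicAlgCl p)) continuous_subtype_val =
      rE₀.baseChange (algebraMap E₀ (PadicAlgCl p)) continuous_subtype_val :=
    ContinuousMonoidHom.ext fun g => Units.ext (Matrix.ext fun i j => rfl)
  have hmodel' : HasQlModel ρ E' rE' := ⟨Q, by rw [hbc, hQ]⟩
  have hρeq : ρ = (rE'.baseChange (algebraMap E' (PadicAlgCl p)) continuous_subtype_val).conj Q := by
    rw [hbc, hQ]
  -- the enlarged model is admissible (model independence of de Rham-ness)
  have hadm : 𝔅.IsAdmissible ((FramedRep.toContinuousRep rE').restrictScalars ℚ_[p]) :=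
    hρ.isAdmissible_of_hasQlModel ‹Algebra ℚ_[p] K› 𝔅 hmodel'
  -- the embedding `τ` factors through `E'`
  let τ₀ : K →ₐ[ℚ_[p]] E' := (IntermediateField.inclusion (hE' τ)).comp τ.equivFieldRange.toAlgHom
  have hτ : τ.toRingHom = (extEmb (E := PadicAlgCl p) τ₀).toRingHom := RingHom.ext fun x => rfl
  -- dimension `n` and finiteness over `E'`
  haveI : ContinuousSMul ℚ_[p] E' := IntermediateField.continuousSMul_padicAlgCl E'
  obtain ⟨hfinE', hrank⟩ := 𝔅.finrank_labelD_eq_of_isAdmissible hB (E := E') hsplit rE' hadm τ₀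
  haveI := hfinE'
  -- finiteness over `ℚ̄_p`: `D_τ(ρ) = (Q ⊗ 1) (ℚ̄_p · ι(D_{τ₀}(rE')))`
  have hfin : FiniteDimensional (PadicAlgCl p) (𝔅.labelD (FramedRep.toContinuousRep ρ) τ.toRingHom) := by
    rw [hρeq, 𝔅.labelD_conj, hτ, 𝔅.labelD_baseChange_eq_span rE' continuous_subtype_val hsplit τ₀]
    haveI := PeriodRingData.finiteDimensional_span_image (E := PadicAlgCl p)
      (𝔅.coeffIncl (E := PadicAlgCl p) n) (𝔅.labelD (FramedRep.toContinuousRep rE') τ₀.toRingHom)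
    infer_instance
  refine ⟨hfin, ?_⟩
  rw [hρeq, 𝔅.finrank_labelD_conj, hτ, 𝔅.finrank_labelD_baseChange rE' continuous_subtype_val hsplit τ₀]
  exact hrank

/-- **`D_τ(ρ)` of a de Rham `ρ : Γ_K →ₜ* GL_n(ℚ̄_p)` is finite-dimensional over `ℚ̄_p`** (period ring a
field, `K/ℚ_p` finite). [cite: FontaineAsterisque223III, Exp. III Prop. 1.5.2] -/
theorem finiteDimensional_labelD [FiniteDimensional ℚ_[p] K]
    (𝔅 : PeriodRingData.{0, 0, 0, 0} (absoluteGaloisGroup K) ℚ_[p] K) (hB : IsField 𝔅.B) {n : ℕ}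
    {ρ : FramedRep (absoluteGaloisGroup K) (PadicAlgCl p) n}
    (hρ : ρ.IsDeRhamWith ‹Algebra ℚ_[p] K› 𝔅) (τ : K →ₐ[ℚ_[p]] PadicAlgCl p) :
    FiniteDimensional (PadicAlgCl p) (𝔅.labelD (FramedRep.toContinuousRep ρ) τ.toRingHom) :=
  (hρ.finiteDimensional_labelD_and_finrank_eq 𝔅 hB τ).1

/-- **`dim_{ℚ̄_p} D_τ(ρ) = n` for a de Rham `ρ : Γ_K →ₜ* GL_n(ℚ̄_p)`** (period ring a field, `K/ℚ_p`
finite): `D(ρ)` is free of rank `n` over `K ⊗_{ℚ_p} ℚ̄_p`.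
[cite: FontaineAsterisque223III, Exp. III Prop. 1.5.2] [cite: Patrikis2019, §2.7.1] -/
theorem finrank_labelD_eq [FiniteDimensional ℚ_[p] K]
    (𝔅 : PeriodRingData.{0, 0, 0, 0} (absoluteGaloisGroup K) ℚ_[p] K) (hB : IsField 𝔅.B) {n : ℕ}
    {ρ : FramedRep (absoluteGaloisGroup K) (PadicAlgCl p) n}
    (hρ : ρ.IsDeRhamWith ‹Algebra ℚ_[p] K› 𝔅) (τ : K →ₐ[ℚ_[p]] PadicAlgCl p) :
    Module.finrank (PadicAlgCl p) (𝔅.labelD (FramedRep.toContinuousRep ρ) τ.toRingHom) = n :=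
  (hρ.finiteDimensional_labelD_and_finrank_eq 𝔅 hB τ).2

/-- **A de Rham `ρ : Γ_K →ₜ* GL_n(ℚ̄_p)` has exactly `n` labelled Hodge–Tate weights at every
`ℚ_p`-embedding `τ : K → ℚ̄_p`**, counted with multiplicity: `card HT_τ(ρ) = n` (period ring a field,
`K/ℚ_p` finite).  [cite: Patrikis2019, §2.3.1 and §2.7.1] [cite: BuzzardGeeLMS2014, §2.4]
[cite: FontaineAsterisque223III, Exp. III Prop. 1.5.2] -/
theorem card_labelledHodgeTateWeights_eq [FiniteDimensional ℚ_[p] K]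
    (𝔅 : PeriodRingData.{0, 0, 0, 0} (absoluteGaloisGroup K) ℚ_[p] K) (hB : IsField 𝔅.B) {n : ℕ}
    {ρ : FramedRep (absoluteGaloisGroup K) (PadicAlgCl p) n}
    (hρ : ρ.IsDeRhamWith ‹Algebra ℚ_[p] K› 𝔅) (τ : K →ₐ[ℚ_[p]] PadicAlgCl p) :
    Multiset.card (𝔅.labelledHodgeTateWeights (FramedRep.toContinuousRep ρ) τ.toRingHom) = n := by
  haveI := hρ.finiteDimensional_labelD 𝔅 hB τ
  rw [𝔅.card_labelledHodgeTateWeights_eq_finrank, hρ.finrank_labelD_eq 𝔅 hB τ]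

end FramedRep.IsDeRhamWith

/-! ### A `p`-adic Hodge datum whose period ring is a field -/

namespace PstWeilDeligneData.IsDeRhamFramed

variable {K : Type} [Field K] [ValuativeRel K] [TopologicalSpace K] [IsNonarchimedeanLocalField K]
  {p : ℕ} [Fact p.Prime]

/-- **`card HT_τ(ρ) = n` for `ρ` de Rham relative to a `p`-adic Hodge datum `𝔇` whose period ring is a
field** (e.g. THE pinned datum, `fontainePst_card_labelledHodgeTateWeights_eq`), at every
`ℚ_p`-embedding `τ : K → ℚ̄_p` for `𝔇.algebra`, provided `K/ℚ_p` is finite for that structure.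
[cite: Patrikis2019, §2.7.1] [cite: FontaineAsterisque223III, Exp. III Prop. 1.5.2] -/
theorem card_labelledHodgeTateWeights_eq (𝔇 : PstWeilDeligneData K p)
    (hB : letI := 𝔇.algebra; IsField 𝔇.𝔅.B)
    (hK : letI := 𝔇.algebra; FiniteDimensional ℚ_[p] K) {n : ℕ}
    {ρ : FramedRep (absoluteGaloisGroup K) (PadicAlgCl p) n} (hρ : 𝔇.IsDeRhamFramed ρ) :
    letI := 𝔇.algebra
    ∀ τ : K →ₐ[ℚ_[p]] PadicAlgCl p,
      Multiset.card (𝔇.𝔅.labelledHodgeTateWeights (FramedRep.toContinuousRep ρ) τ.toRingHom) = n := by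
  letI := 𝔇.algebra
  haveI := hK
  intro τ
  exact FramedRep.IsDeRhamWith.card_labelledHodgeTateWeights_eq 𝔇.𝔅 hB hρ τ

/-- … and `D_τ(ρ)` is finite-dimensional over `ℚ̄_p` of dimension `n`. [cite: Patrikis2019, §2.7.1] -/
theorem finiteDimensional_labelD_and_finrank_eq (𝔇 : PstWeilDeligneData K p)
    (hB : letI := 𝔇.algebra; IsField 𝔇.𝔅.B)
    (hK : letI := 𝔇.algebra; FiniteDimensional ℚ_[p] K) {n : ℕ}
    {ρ : FramedRep (absoluteGaloisGroup K) (PadicAlgCl p) n} (hρ : 𝔇.IsDeRhamFramed ρ) :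
    letI := 𝔇.algebra
    ∀ τ : K →ₐ[ℚ_[p]] PadicAlgCl p,
      FiniteDimensional (PadicAlgCl p) (𝔇.𝔅.labelD (FramedRep.toContinuousRep ρ) τ.toRingHom) ∧
        Module.finrank (PadicAlgCl p) (𝔇.𝔅.labelD (FramedRep.toContinuousRep ρ) τ.toRingHom) = n := by
  letI := 𝔇.algebra
  haveI := hK
  intro τ
  exact FramedRep.IsDeRhamWith.finiteDimensional_labelD_and_finrank_eq 𝔇.𝔅 hB hρ τ

end PstWeilDeligneData.IsDeRhamFramed

end Literature.NumberTheory.GaloisRepresentations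

/-! ### Rigidity of continuous ring maps out of `ℚ_p` -/

/-- **A continuous ring homomorphism out of `ℚ_p` into a Hausdorff topological ring is unique**: two
such maps agree on `ℤ`, hence on its closure `ℤ_p` (Mathlib `PadicInt.denseRange_intCast`), hence on
`ℚ_p = Frac ℤ_p` (`IsLocalization.ringHom_ext`).  (For a LOCAL-field target the tree has the stronger
`LocalField.ringHom_padic_ext`, without continuity.) [cite: SerreLocalFields1979, Ch. II §5] -/
theorem RingHom.padic_ext_of_continuous {p : ℕ} [Fact p.Prime] {R : Type*} [Ring R]
    [TopologicalSpace R] [T2Space R] (φ ψ : ℚ_[p] →+* R) (hφ : Continuous φ) (hψ : Continuous ψ) :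
    φ = ψ := by
  have hZ : φ.comp (PadicInt.Coe.ringHom (p := p)) = ψ.comp (PadicInt.Coe.ringHom (p := p)) := by
    have hc : Continuous ((↑) : ℤ_[p] → ℚ_[p]) := continuous_subtype_val
    have h := Continuous.ext_on (PadicInt.denseRange_intCast (p := p)) (hφ.comp hc) (hψ.comp hc)
      (by rintro _ ⟨a, rfl⟩; simp)
    exact RingHom.ext fun x => congrFun h x
  exact IsLocalization.ringHom_ext (nonZeroDivisors ℤ_[p]) hZ

/-! ### THE pinned datum: Fontaine's `B_dR(F)` -/

namespace Literature.NumberTheory.PAdicHodge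

open ValuativeRel IsDedekindDomain
open Literature.NumberTheory.GaloisRepresentations
open Literature.NumberTheory.GaloisRepresentations.IsNonarchimedeanLocalField

section Local

variable {F : Type} [Field F] [ValuativeRel F] [TopologicalSpace F] [IsNonarchimedeanLocalField F]
  [CharZero F] {p : ℕ} [Fact p.Prime]

/-- **`F/ℚ_p` is finite for the canonical `ℚ_p`-structure** `LocalField.padicAlgebra` (the accepted
`PadicBase.instFiniteDimensional`, read on `ℚ_[p]` itself: `PadicBase F p hp` is a synonym of `ℚ_[p]`
with the same algebra map). [cite: NeukirchANT1999, Ch. II (5.2)] -/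
theorem finiteDimensional_padicAlgebra (hp : valuation F p < 1) :
    letI := LocalField.padicAlgebra F p hp; FiniteDimensional ℚ_[p] F :=
  PadicBase.instFiniteDimensional (F := F) (p := p) hp

/-- `F/ℚ_p` is finite for the `ℚ_p`-structure of THE pinned datum (which is the canonical one,
accepted `fontainePst_algebra_eq_padicAlgebra`). [folklore] -/
theorem fontainePst_finiteDimensional (hp : valuation F p < 1) :
    letI := (fontainePst F p hp).algebra; FiniteDimensional ℚ_[p] F := by
  rw [fontainePst_algebra_eq_padicAlgebra hp]
  exact finiteDimensional_padicAlgebra hp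

/-- The period ring of THE pinned datum is a field (it is `B_dR(F) = Frac B_dR⁺(F)`, accepted
`fontainePst_𝔅_eq_bdRPeriodRingData`). [cite: FontaineAsterisque223III, Exp. II §1.5.5] -/
theorem isField_fontainePst_B (hp : valuation F p < 1) :
    letI := (fontainePst F p hp).algebra; IsField (fontainePst F p hp).𝔅.B := by
  letI := (fontainePst F p hp).algebra
  haveI : Fact (¬ IsUnit ((p : ℕ) : integerC F)) := ⟨not_isUnit_natCast_integerC hp⟩
  haveI : IsAdicComplete (Ideal.span {((p : ℕ) : integerC F)}) (integerC F) :=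
    isAdicComplete_integerC_natCast hp
  haveI := isDomain_bDeRhamPlus (F := F) (p := p) (surjective_fontaineTheta_integerC hp)
  rw [fontainePst_𝔅_eq_bdRPeriodRingData hp]
  exact Field.toIsField (FracBdR F p)

/-- **A representation de Rham for THE pinned datum has exactly `n` labelled Hodge–Tate weights at
every `ℚ_p`-embedding `τ : F → ℚ̄_p` — unconditionally** (`card HT_τ(ρ) = n`; Fontaine's `B_dR(F)` is a
field and `F/ℚ_p` is finite).  [cite: Patrikis2019, §2.7.1] [cite: BuzzardGeeLMS2014, §2.4]
[cite: FontaineAsterisque223III, Exp. III Prop. 1.5.2] -/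
theorem fontainePst_card_labelledHodgeTateWeights_eq (hp : valuation F p < 1) {n : ℕ}
    {ρ : FramedRep (absoluteGaloisGroup F) (PadicAlgCl p) n} (hρ : (fontainePst F p hp).IsDeRhamFramed ρ) :
    letI := (fontainePst F p hp).algebra
    ∀ τ : F →ₐ[ℚ_[p]] PadicAlgCl p,
      Multiset.card ((fontainePst F p hp).𝔅.labelledHodgeTateWeights (FramedRep.toContinuousRep ρ)
        τ.toRingHom) = n :=
  hρ.card_labelledHodgeTateWeights_eq _ (isField_fontainePst_B hp) (fontainePst_finiteDimensional hp)

/-- … and `dim_{ℚ̄_p} D_τ(ρ) = n` with `D_τ(ρ)` finite-dimensional. [cite: Patrikis2019, §2.7.1] -/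
theorem fontainePst_finiteDimensional_labelD_and_finrank_eq (hp : valuation F p < 1) {n : ℕ}
    {ρ : FramedRep (absoluteGaloisGroup F) (PadicAlgCl p) n} (hρ : (fontainePst F p hp).IsDeRhamFramed ρ) :
    letI := (fontainePst F p hp).algebra
    ∀ τ : F →ₐ[ℚ_[p]] PadicAlgCl p,
      FiniteDimensional (PadicAlgCl p)
          ((fontainePst F p hp).𝔅.labelD (FramedRep.toContinuousRep ρ) τ.toRingHom) ∧
        Module.finrank (PadicAlgCl p)
          ((fontainePst F p hp).𝔅.labelD (FramedRep.toContinuousRep ρ) τ.toRingHom) = n :=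
  hρ.finiteDimensional_labelD_and_finrank_eq _ (isField_fontainePst_B hp)
    (fontainePst_finiteDimensional hp)

end Local

/-! ### The summit's datum at `v ∣ p`: continuous labels `τ : K_v →+* ℚ̄_p` -/

section NumberField

variable {K : Type} [Field K] [NumberField K] {p : ℕ} [Fact p.Prime]

/-- **A continuous `τ : K_v →+* ℚ̄_p` is `ℚ_p`-linear** for the `ℚ_p`-structure of THE pinned datum at
`v ∣ p` (the canonical one): `τ ∘ (ℚ_p → K_v)` and `ℚ_p → ℚ̄_p` are continuous ring maps out of `ℚ_p`,
hence equal (`RingHom.padic_ext_of_continuous`). [cite: SerreLocalFields1979, Ch. II §5] -/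
theorem adicCompletion_ringHom_commutes_of_continuous (v : HeightOneSpectrum (𝓞 K)) (hv : ((p : ℕ) : 𝓞 K) ∈ v.asIdeal)
    (τ : v.adicCompletion K →+* PadicAlgCl p) (hτ : Continuous τ) (c : ℚ_[p]) :
    letI := (fontainePstAdicCompletion v p hv).algebra
    τ (algebraMap ℚ_[p] (v.adicCompletion K) c) = algebraMap ℚ_[p] (PadicAlgCl p) c := by
  rw [fontainePstAdicCompletion_algebra_eq_adicCompletionPadicAlgebra]
  letI := LocalField.adicCompletionPadicAlgebra v p hv
  have h := RingHom.padic_ext_of_continuous (τ.comp (algebraMap ℚ_[p] (v.adicCompletion K)))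
    (algebraMap ℚ_[p] (PadicAlgCl p))
    (hτ.comp (LocalField.continuous_algebraMap_adicCompletionPadicAlgebra v p hv))
    (continuous_algebraMap ℚ_[p] (PadicAlgCl p))
  exact RingHom.congr_fun h c

/-- **The labelled Hodge–Tate weights of the summit statements at a de Rham place have exactly `n`
elements.**  For `ρ : Γ_K →ₜ* GL_n(ℚ̄_p)` (`K` a number field), a place `v ∣ p` at which `ρ|_{Γ_{K_v}}`
is de Rham for THE pinned datum `fontainePstAdicCompletion v p hv`, and every CONTINUOUS label
`τ : K_v →+* ℚ̄_p`: `card HT_τ(ρ|_{Γ_{K_v}}) = n` (`FramedGaloisRep.labelledHodgeTateWeightsAt`).  In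
particular, for `n = 2`, "multiplicity-free labelled weights" means two distinct integers `a < b`.
[cite: Patrikis2019, §2.7.1] [cite: BuzzardGeeLMS2014, §2.4] [cite: Pan2022LocallyAnalyticII, Thm. 1.1.2 (2) and §7.2.1] -/
theorem _root_.Literature.NumberTheory.GaloisRepresentations.FramedGaloisRep.card_labelledHodgeTateWeightsAt_eq_of_isDeRhamFramed
    {n : ℕ} (ρ : FramedGaloisRep K (PadicAlgCl p) n) (v : HeightOneSpectrum (𝓞 K))
    (hv : ((p : ℕ) : 𝓞 K) ∈ v.asIdeal)
    (hρ : (fontainePstAdicCompletion v p hv).IsDeRhamFramed (ρ.toLocal v))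
    (τ : v.adicCompletion K →+* PadicAlgCl p) (hτ : Continuous τ) :
    Multiset.card (ρ.labelledHodgeTateWeightsAt v (fontainePstAdicCompletion v p hv).algebra
      (fontainePstAdicCompletion v p hv).𝔅 τ) = n := by
  haveI := LocalField.charZero_adicCompletion v
  letI := (fontainePstAdicCompletion v p hv).algebra
  let τ' : v.adicCompletion K →ₐ[ℚ_[p]] PadicAlgCl p := ⟨τ, adicCompletion_ringHom_commutes_of_continuous v hv τ hτ⟩
  have h := fontainePst_card_labelledHodgeTateWeights_eq
    (LocalField.valuation_adicCompletion_natCast_lt_one v p hv) hρ τ'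
  rw [FramedGaloisRep.labelledHodgeTateWeightsAt_def]
  exact h

/-- **Rank two: the labelled weights at a de Rham place are `{a, b}` with `a < b` as soon as they are
multiplicity-free** — the reading of the clause "de Rham at `v ∣ p` with distinct labelled Hodge–Tate
weights" of the `GL₂` Fontaine–Mazur statements of the tree as Pan's hypothesis "Hodge–Tate weights
`0, k` (`k > 0`) up to a Tate twist". [cite: Pan2022LocallyAnalyticII, Thm. 1.1.2 (2) and §7.2.1] -/
theorem _root_.Literature.NumberTheory.GaloisRepresentations.FramedGaloisRep.exists_labelledHodgeTateWeightsAt_eq_pair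
    (ρ : FramedGaloisRep K (PadicAlgCl p) 2) (v : HeightOneSpectrum (𝓞 K))
    (hv : ((p : ℕ) : 𝓞 K) ∈ v.asIdeal)
    (hρ : (fontainePstAdicCompletion v p hv).IsDeRhamFramed (ρ.toLocal v))
    (τ : v.adicCompletion K →+* PadicAlgCl p) (hτ : Continuous τ)
    (hnodup : (ρ.labelledHodgeTateWeightsAt v (fontainePstAdicCompletion v p hv).algebra
      (fontainePstAdicCompletion v p hv).𝔅 τ).Nodup) :
    ∃ a b : ℤ, a < b ∧
      ρ.labelledHodgeTateWeightsAt v (fontainePstAdicCompletion v p hv).algebra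
        (fontainePstAdicCompletion v p hv).𝔅 τ = {a, b} := by
  set S := ρ.labelledHodgeTateWeightsAt v (fontainePstAdicCompletion v p hv).algebra
    (fontainePstAdicCompletion v p hv).𝔅 τ with hS
  have hcard : Multiset.card S = 2 := ρ.card_labelledHodgeTateWeightsAt_eq_of_isDeRhamFramed v hv hρ τ hτ
  obtain ⟨x, y, hxy⟩ := Multiset.card_eq_two.1 hcard
  have hne : x ≠ y := by
    rintro rfl
    rw [hxy, Multiset.insert_eq_cons] at hnodup
    exact (Multiset.nodup_cons.1 hnodup).1 (Multiset.mem_singleton_self x)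
  rcases lt_or_gt_of_ne hne with h | h
  · exact ⟨x, y, h, hxy⟩
  · exact ⟨y, x, h, by rw [hxy, Multiset.pair_comm]⟩

end NumberField

end Literature.NumberTheory.PAdicHodge

end
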